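import Mathlib
import Summits.ValiantsHypothesis.ValiantsHypothesis.Cruxes.OrbitDimensionBound.Lines.GaugeLadder

/-!
# F3 SPECIAL-CASE WITNESSES for the rung `Gauge.AffineGaugeShadow` (line `affine_gauge`)

(a) the FLOOR is the family member `q = 0` (gauge degree `0` = constant lifts) — `gaugeCovering_zero_iff` + the seed;
(b) the floor's parameter value of the SHADOW form (the rung's shape) is a theorem one line from the seed;
(c) rung ⇒ floor in both forms (numeric and shadow), one line each;
(d) the relaxed symmetrisation target is implied by the host crux, one line;
(e) the `r = 0` engine at `q = 0` is the landed `stub_torusBound`, one line.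
[cite: LandsbergRessayre2017, Thm. 2.8]
-/

set_option linter.dupNamespace false

namespace Summit.ValiantsHypothesis.ValiantsHypothesis.Cruxes.OrbitDimensionBound.Gauge.Special

open Literature.Computability.AlgebraicComplexity
open Summit.ValiantsHypothesis.ValiantsHypothesis.Cruxes.OrbitDimensionBound.Confusion
open Summit.ValiantsHypothesis.ValiantsHypothesis.Cruxes.OrbitDimensionBound.Gauge

/-- (a) the floor IS the member `q = 0` of the family: `GaugeCovering 0 ↔ SubtorusCovering`, and the seed proves it.
[cite: LandsbergRessayre2017, Thm. 2.8] -/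
example : GaugeCovering 0 :=
  gaugeCovering_zero_iff.mpr
    Summit.ValiantsHypothesis.ValiantsHypothesis.Theorems.FreeSubtorusSubtorusCovering.subtorusCovering_proof

/-- (a') the identification, by name. [cite: LandsbergRessayre2017, Def. 1.3, Thm. 2.8] -/
example : GaugeCovering 0 ↔ Summit.ValiantsHypothesis.ValiantsHypothesis.Theses.FreeSubtorus.SubtorusCovering :=
  gaugeCovering_zero_iff

/-- (b) the rung's SHAPE (`GaugeShadow q`) at the floor's parameter `q = 0` is a theorem (seed +
`not_isPBounded_choose_middle`), and it IS gen 1's floor shadow `CoveringShadow powLoss`. [cite: LandsbergRessayre2017, Thm. 2.8] -/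
theorem gaugeShadow_zero_of_seed : GaugeShadow 0 :=
  gaugeShadow_of_gaugeCovering (gaugeCovering_zero_iff.mpr
    Summit.ValiantsHypothesis.ValiantsHypothesis.Theorems.FreeSubtorusSubtorusCovering.subtorusCovering_proof)

example : GaugeShadow 0 ↔ CoveringShadow powLoss := gaugeShadow_zero_iff

/-- (c) rung ⇒ floor, numeric form. [cite: LandsbergRessayre2017, Thm. 2.8] -/
example (h : AffineGaugeCovering) :
    Summit.ValiantsHypothesis.ValiantsHypothesis.Theses.FreeSubtorus.SubtorusCovering :=
  subtorusCovering_of_gaugeCovering h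

/-- (c') rung ⇒ floor, shadow form. [cite: LandsbergRessayre2017, Thm. 2.8] -/
example (h : AffineGaugeShadow) : CoveringShadow powLoss :=
  powShadow_of_affineGaugeShadow h

/-- (c'') at a representation with CONSTANT lifts (the floor's hypothesis) the rung's hypothesis holds at every gauge
degree: constant lifts are degree-`q` lifts. [cite: LandsbergRessayre2017, Def. 1.3] -/
example (q n m r : ℕ) (Λ : Fin r → (Fin n ⊕ Fin n) → ℤ) (B : Matrix (Fin m) (Fin m) (MvPolynomial (Fin n × Fin n) ℂ))
    (hB : IsEquivariantDetRepr (Subgroup.closure (subtorusGen n r Λ)) (perPoly (Fin n) ℂ) B) :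
    GaugeLifts q (subtorusGen n r Λ) B :=
  GaugeLifts.mono (Nat.zero_le q)
    ((gaugeLifts_zero_iff _ _).mpr fun γ hγ => hB.2 γ (Subgroup.subset_closure hγ))

/-- (d) the relaxed symmetrisation target follows from the host crux. [cite: LandsbergRessayre2017, Question 2.2] -/
example (h : Summit.ValiantsHypothesis.ValiantsHypothesis.Theses.FreeSubtorus.OrbitDimensionBound) :
    OrbitGaugeBound 1 :=
  orbitGaugeBound_of_orbitDimensionBound 1 h

/-- (e) the `r = 0` engine at `q = 0` is landed. [cite: LandsbergRessayre2017, Thm. 2.8] -/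
example : GaugeTorusBound 0 := gaugeTorusBound_zero

end Summit.ValiantsHypothesis.ValiantsHypothesis.Cruxes.OrbitDimensionBound.Gauge.Special
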